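import Summits.QuantumFields.YangMills.Theorems.BalabanUVNodesSpineReadingOfRecord13CoPHKRatioDominationBankedChronoOfRecordCeilingUndressedAE
import Literature.MathematicalPhysics.QuantumFieldTheory.Balaban1983to89.T4ContinuumYM4Torus

/-!
# N20 (NE7b) ON THE TOWER-FREE ROAD — THE UNDRESSED FACE UNDER THE ITEM'S OWN PREFIX: the margins `κ₁, E₀` from the constants, then for every carrier tuple ON THE LIVE LINE the
# conclusion holds `ForSmallCouplings (datumOfRecord₁₃CoPH θ hP)` — for all small `γ, g` and EVERY bare sequence `g₀` TUNED in `]0, γ]` — from (2.7), the per-cutoff schedules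
# with undressed one-component a.e. letters, (b), (ID) and the cut; the interval row of (F) is GONE (it IS the tuning binder) and the face's coupling ceiling IS the prefix's threshold

Cell `pub-ymgap`, YM-PLAN Track A (HUMAN RULING D-0062); seat `pub-ymgap-dag-n20-d` (R134 (a) N20 NE7b s3 — «alternative currency»), gen 45 — director-ym №374 line (E), road [e]
TOWER-FREE of record (№377).  `--kind proof --supports stmt-QuantumFields-27366 --as helper` (K3⁸); COUNT-NEUTRAL helper ∕ NOT a discharge; THEOREMS ONLY (0 `def`).
[I] = [Balaban1987RG1]; [III] = [Balaban1988Convergent]; [LF-II] = [Balaban1989LargeFieldII].  Companions BY NAME: ✓p790143 `…CeilingUndressedAE.…_ofRecord_undressedAE_of_liveSel`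
(gen 45: the face on the live line in print's undressed currency), `T4ContinuumYM4Torus.ForSmallCouplings` (the discharged quantifier prefix of the apex: `∃ γ₀ > 0, ∀ γ ∈ ]0, γ₀],
∃ g₁ > 0, ∀ g ∈ ]0, g₁], ∀ g₀, D.Tuned γ g g₀ → …`, [I] Thm 2 p. 259), def-T's `Node00.flow_g_datumOfRecord₁₃CoPH` (the datum's run flow IS `gOfRecord₁₃`, `rfl`), dag-n20-w3's
`…N20KeyReadingRoadUnderPrefix.spineGivenEndpointR13SepCoPHV_of_liveLine_of_fscFacesK` (K3⁸ BY NAME from the four faces stated INSIDE `ForSmallCouplings` at the slot datum).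

WHY (the item's own prefix).  K3⁸ `SpineGivenEndpointR13SepCoPHV` is, per slot tuple, «(B) → END → `ForSmallCouplings (slot datum) (g₀ ↦ ∀ os, …)`»
(`T4ContinuumYM4Torus.underHypotheses_iff`), and dag-n20-w3's composer consumes the N20 conjunct `RelWeightBound` at the `kr`-coarse carriers INSIDE that prefix.  The road-[e] faces
(✓p782644 → ✓p786169 → ✓p790143) are stated with a coupling ceiling `γ₀` chosen from the constants BEFORE the rank and the carriers, and with the (F) row «the histories of record
stay in `]0, γ₀]`» (`∀ K, Step.InInterval γ₀ (K₀ + K) (histA₁₃ θ K₀ g₀ K)`).  At the datum of record that row IS the prefix's tuning binder: `D.Tuned γ g g₀` says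
`(D.C ⟨K′, F.m, g₀ K′⟩).flow.InInterval γ K′` for every `K′`, the datum's run flow is `gOfRecord₁₃ θ ⟨K′, …⟩` by `rfl` (`flow_g_datumOfRecord₁₃CoPH`), and `histA₁₃ θ K₀ g₀ K` is that
history at `K′ = K₀ + K`; with `γ ≤ γ₀` the row follows.  So the face's `γ₀` serves as the prefix's threshold, ANY `g₁` serves (the face does not read the renormalised coupling
`g`), and the face holds in the prefix's currency with the interval row struck — the kernel form of «same quantifier order as the prefix» (memos g43 ∕ g44 §4).  (2.7) stays
displayed inside (B14's currency: the flow inequalities are NOT part of the tuning); (B) and END are not read by N20's face at all.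

WHAT IS PROVED (kernel; zero `sorry`).  ★★★ `forSmallCouplings_relWeightBound_chronoGenealogies_ofRecord_undressedAE_of_liveSel`: `∃ κ₁ E₀ ≥ 0`, `L^4·e^{η̄₊−κ₁} < 1`, such that for every
rank, `(θ, hP, K₀, kr, bd)`, cut, slopes with `1 + β₀ ≤ L`, the live-line rows (`hsel`, (H-U), `0 ≤ θ.ζ`) and caps: `ForSmallCouplings (datumOfRecord₁₃CoPH F N θ hP) (g₀ ↦ (2.7) along
the histories of record → ∀ os, per-K schedules + UNDRESSED one-component a.e. letters + (b) + (ID) (both runs) → RelWeightBound 1 (classSetK₁₃ …) (weightAK₁₃ …) (weightBK₁₃ …)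
(badClassK₁₃ …) (K ↦ 1 − exp(−S_K)))` — ✓p790143 with `hI` supplied by the tuning.

WHAT STAYS DISPLAYED (NOT PRINTED as theorems of [LF-II] for `d = 4`, NOT proved here): exactly ✓p790143's census MINUS the interval row — (a′) undressed one-component letters
`dV`-a.e. + schedules (NC-NE7b-α UNRULED; object-bound (A1c)); (b), (ID); (2.7) (B14); cut; live line; `hP : θ.Provisos₁₃CoPH` (K0⁷).  The prefix is VACUOUSLY met at a datum with
no tuned sequence (`T4ContinuumYM4Torus`'s located vacuity source; tuned sequences exist under END) — a property of K3⁸'s statement, not of this file.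

HONEST FRAMING.  [bookkeeping]: one instantiation; no estimate.  NOTHING of Bałaban's is asserted; NE7 ∕ NE7b ∕ NE7c NOT PRINTED for `d = 4` ∕ NOT proved; no `Provisos₁₃CoPH`
inhabitant claimed (K0⁷ OPEN); (B), END, K3⁸ untouched; N20 NOT discharged; counts UNMOVED (typed 28∕28 · discharged 8∕27); one finite four-torus programme at fixed `ε` — NOT
ℝ⁴, NOT OS, NOT a mass gap, NOT the Clay problem.  No `def`, no `instance`, no `notation`, no `sorry`; no decl below carries a cite tag.
-/

noncomputable section

open MeasureTheory
open scoped BigOperators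
open Finset

namespace YMDAG.UVSplit

open Literature.MathematicalPhysics.QuantumFieldTheory.Balaban1983to89
open Literature.MathematicalPhysics.QuantumFieldTheory.Balaban1983to89.T4Continuum
open Literature.MathematicalPhysics.QuantumFieldTheory.Balaban1983to89.Node00
open Literature.MathematicalPhysics.QuantumFieldTheory.Balaban1983to89.B15.BasicStep (fibreIntegral)
open Literature.MathematicalPhysics.QuantumFieldTheory.Balaban1983to89.T4ContinuumYM4Torus (ForSmallCouplings)
open T4WeightBudget (RelWeightBound)
open T4PersistenceDictionary (Gen PEv dictW)
open T4BankedInduction (Banking credits lifeCost)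
open T4PartnerMultiplicity (partnerAges)
open T4BranchingRecordsGas (relabel shape)
open T4PrintedShapeBanking (Consistent)
open T4CanonicalMenus (Chrono fuel canonFam birthMass birthMass_nonneg)

/-! ## §1 The undressed face under `ForSmallCouplings (datumOfRecord₁₃CoPH θ hP)` -/

section Prefix

variable {F : T4Family}

open scoped Classical in
/-- ★★★ **THE N20 UNDRESSED FACE UNDER THE ITEM'S OWN PREFIX.**  For print's valid constants `C₀`, `β₀ ≥ 0`, a window exponent `r` with `r(q′+1) < p₀`, ANY `M ≥ 0` and `η̄₊ > 0`
there are margins `κ₁, E₀ ≥ 0` with `L^4·e^{η̄₊−κ₁} < 1` such that for every rank, tuple `(θ, hP)`, `K₀`, key reading `kr`, bad-key reading `bd`, cut (`j⋆(K) ≤ K`, `c·K ≤ K − j⋆(K)`),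
slopes `β′ ≥ 0` with `1 + β₀ ≤ L`, ON THE LIVE LINE (`hsel`, (H-U), `0 ≤ θ.ζ`) and for all caps: `ForSmallCouplings (datumOfRecord₁₃CoPH F N θ hP) (g₀ ↦ …)` — for all small
`γ, g` and EVERY bare sequence `g₀` tuned in `]0, γ]` ([I] Thm 2 p. 259): IF the histories of record obey (2.7) up to their level, THEN for every loop string `os`, the per-cutoff
removal schedules with UNDRESSED one-component a.e. letters (factor `e^{−2}·e^{−credits}·e^{+lifeCost}`), good ends, filing, data and labels (b), multiplicities (ID) — both runs —
give `RelWeightBound 1 (classSetK₁₃ …) (weightAK₁₃ …) (weightBK₁₃ …) (badClassK₁₃ …) (K ↦ 1 − exp(−S_K))`.  (✓p790143 with its ceiling `γ₀` as the prefix's threshold, `g₁ := 1`,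
and the interval row from `D.Tuned γ g g₀` by `flow_g_datumOfRecord₁₃CoPH` and `γ ≤ γ₀`.) [bookkeeping] -/
theorem forSmallCouplings_relWeightBound_chronoGenealogies_ofRecord_undressedAE_of_liveSel {X : Type*} (C₀ : T4PrintedShapeBanking.Consts) (hCv : C₀.Valid) (ha : 0 < C₀.a)
    (hA : 0 < C₀.A₀) (hμ₀ : 0 < C₀.μ) {r : ℕ} {β₀ : ℝ} (hβ : 0 ≤ β₀) (hrq : r * (C₀.q' + 1) < C₀.p₀) {M ηplus : ℝ} (hM : 0 ≤ M) (hη : 0 < ηplus) :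
    ∃ κ₁ E₀ : ℝ, 0 ≤ κ₁ ∧ 0 ≤ E₀ ∧ (F.L : ℝ) ^ 4 * Real.exp (ηplus - κ₁) < 1 ∧
      ∀ {N : ℕ} [NeZero N] (θ : Stage13HParams F N) (hP : θ.Provisos₁₃CoPH F N) (K₀ : ℕ)
      (kr : ℕ → (Σ K, SiteSeqKey F (K₀ + K)) → (Σ K, SiteSeqKey F (K₀ + K))) (bd : ℕ → (Σ K, SiteSeqKey F (K₀ + K)) → Prop) (c : ℝ), 0 < c →
      ∀ (jstar : ℕ → ℕ), (∀ K, jstar K ≤ K) → (∀ K : ℕ, c * K ≤ ((K - jstar K : ℕ) : ℝ)) →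
      ∀ (β' : ℕ → ℝ), (∀ K, 0 ≤ β' K) → 1 + β₀ ≤ (F.L : ℝ) →
      θ.ppSel = ppSelLiveOfRecord F N θ.ν θ.τ9 (EOfRecord₁₃ F N θ.toStage13Params) (wOfRecord₉ F N θ.toStage9Params) → LocalBgMeasurable F N θ.ν →
      (∀ p g k s Pl Ql RS U V', 0 ≤ θ.ζ p g k s Pl Ql RS U V') →
      ∀ (Dcap Ncap : ℕ → ℕ),
      ForSmallCouplings (datumOfRecord₁₃CoPH F N θ hP) fun g₀ =>
      (∀ K, B14.FlowIneq27 (histA₁₃ θ K₀ g₀ K) (β' K) β₀ C₀.p₀ (K₀ + K)) →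
      ∀ os : List (ULoop F),
      (∀ (K : ℕ),
        ∃ (n : SeqOfRecord F θ.ν θ.τ9.M (histA₁₃ θ K₀ g₀ K) (K₀ + K) (K₀ + K) → ℕ)
          (chain : (s : SeqOfRecord F θ.ν θ.τ9.M (histA₁₃ θ K₀ g₀ K) (K₀ + K) (K₀ + K)) → Fin (n s + 1) → SeqOfRecord F θ.ν θ.τ9.M (histA₁₃ θ K₀ g₀ K) (K₀ + K) (K₀ + K))
          (comp : (s : SeqOfRecord F θ.ν θ.τ9.M (histA₁₃ θ K₀ g₀ K) (K₀ + K) (K₀ + K)) → Fin (n s) → X)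
          (fibY : X → Finset (PBond (F.P (K₀ + K)) (K₀ + K)))
          (Old : SeqOfRecord F θ.ν θ.τ9.M (histA₁₃ θ K₀ g₀ K) (K₀ + K) (K₀ + K) → Finset X)
          (slot : X → (Σ _ : ℕ, (Fin 4 → ℕ))) (G : X → Gen PEv),
          (∀ s, kr K (keyA₁₃ θ K₀ g₀ K s) ∈ badClassK₁₃ θ K₀ g₀ kr bd K 0 → chain s 0 = s) ∧
          (∀ s, kr K (keyA₁₃ θ K₀ g₀ K s) ∈ badClassK₁₃ θ K₀ g₀ kr bd K 0 → ∀ i : Fin (n s), ∀ᵐ V ∂fieldMeasure (F.P (K₀ + K)) (K₀ + K) (SU N),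
            fibreIntegral (fibY (comp s i)) (fun V => chiSeqOfRecord F N θ.ν θ.τ9.M (histA₁₃ θ K₀ g₀ K) (K₀ + K) (K₀ + K) (chain s i.castSucc) V *
                slotsOfRecord F N θ.ν θ.τ9 (EOfRecord₁₃ F N θ.toStage13Params) (wOfRecord₉ F N θ.toStage9Params) θ.ppSel (runA₁₃ F K₀ g₀ K) (histA₁₃ θ K₀ g₀ K) (K₀ + K) (chain s i.castSucc) V) V ≤
              Real.exp (-2) * (Real.exp (-credits (T4PrintedShapeBanking.credit C₀ (fun j => histA₁₃ θ K₀ g₀ K (min j (K₀ + K)))) (G (comp s i))) *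
              Real.exp (lifeCost (dictW (fun s => RkOfRecord F.L r (histA₁₃ θ K₀ g₀ K s)) C₀.n₁) (T4PrintedShapeBanking.cost C₀ (K₀ + K) (fun s => RkOfRecord F.L r (histA₁₃ θ K₀ g₀ K s))) (G (comp s i)))) *
              fibreIntegral (fibY (comp s i)) (fun V => chiSeqOfRecord F N θ.ν θ.τ9.M (histA₁₃ θ K₀ g₀ K) (K₀ + K) (K₀ + K) (chain s i.succ) V *
                slotsOfRecord F N θ.ν θ.τ9 (EOfRecord₁₃ F N θ.toStage13Params) (wOfRecord₉ F N θ.toStage9Params) θ.ppSel (runA₁₃ F K₀ g₀ K) (histA₁₃ θ K₀ g₀ K) (K₀ + K) (chain s i.succ) V) V) ∧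
          (∀ s, kr K (keyA₁₃ θ K₀ g₀ K s) ∈ badClassK₁₃ θ K₀ g₀ kr bd K 0 → kr K (keyA₁₃ θ K₀ g₀ K (chain s (Fin.last (n s)))) ∉ badClassK₁₃ θ K₀ g₀ kr bd K 0) ∧
          (∀ σ s, kr K (keyA₁₃ θ K₀ g₀ K s) ∈ badClassK₁₃ θ K₀ g₀ kr bd K 0 → chain s (Fin.last (n s)) = σ →
            (∀ i, comp s i ∈ Old σ) ∧ 0 < n s ∧ Function.Injective (comp s)) ∧
          (∀ σ, Set.InjOn (fun s => (Finset.univ : Finset (Fin (n s))).image (comp s)) {s | kr K (keyA₁₃ θ K₀ g₀ K s) ∈ badClassK₁₃ θ K₀ g₀ kr bd K 0 ∧ chain s (Fin.last (n s)) = σ}) ∧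
          (∀ σ, ∀ Y ∈ Old σ, (slot Y).1 < K₀ + jstar K) ∧
          (∀ σ, ∀ Y ∈ Old σ, (slot Y).2 ∈ Fintype.piFinset fun _ : Fin 4 => Finset.range (2 * F.L ^ F.m * F.L ^ ((K₀ + K) - (slot Y).1))) ∧
          (∀ σ, ∀ Y ∈ Old σ, Consistent C₀ (K₀ + K) (fun s => RkOfRecord F.L r (histA₁₃ θ K₀ g₀ K s)) (G Y)) ∧
          (∀ σ, ∀ Y ∈ Old σ, (G Y).WF (dictW (fun s => RkOfRecord F.L r (histA₁₃ θ K₀ g₀ K s)) C₀.n₁)) ∧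
          (∀ σ, ∀ Y ∈ Old σ, K₀ + K < (G Y).reach (dictW (fun s => RkOfRecord F.L r (histA₁₃ θ K₀ g₀ K s)) C₀.n₁)) ∧ (∀ σ, ∀ Y ∈ Old σ, Chrono PEv.step (G Y)) ∧
          (∀ σ, ∀ Y ∈ Old σ, ∀ e ∈ (G Y).events, e.kind = 0 → e.fat < Dcap (K₀ + K)) ∧ (∀ σ, ∀ Y ∈ Old σ, fuel (G Y) ≤ Ncap (K₀ + K)) ∧
          (∀ σ, ∀ Y ∈ Old σ, (G Y).rootStep = (slot Y).1) ∧
          (∀ σ, ∀ j < K₀ + jstar K, ∀ zc ∈ (Fintype.piFinset fun _ : Fin 4 => Finset.range (2 * F.L ^ F.m * F.L ^ ((K₀ + K) - j))),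
            ∀ G₀ ∈ canonFam Dcap Ncap (K₀ + K) j,
            ((((Old σ).filter fun Y => slot Y = ⟨j, zc⟩ ∧ relabel shape (G Y) = G₀).card : ℕ) : ℝ) ≤ M ^ partnerAges PEv.step G₀)) →
      (∀ (K : ℕ),
        ∃ (n : SeqOfRecord F θ.ν θ.τ9.M (histB₁₃ θ K₀ g₀ K) (K₀ + K + 1) (K₀ + K + 1) → ℕ)
          (chain : (s : SeqOfRecord F θ.ν θ.τ9.M (histB₁₃ θ K₀ g₀ K) (K₀ + K + 1) (K₀ + K + 1)) → Fin (n s + 1) → SeqOfRecord F θ.ν θ.τ9.M (histB₁₃ θ K₀ g₀ K) (K₀ + K + 1) (K₀ + K + 1))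
          (comp : (s : SeqOfRecord F θ.ν θ.τ9.M (histB₁₃ θ K₀ g₀ K) (K₀ + K + 1) (K₀ + K + 1)) → Fin (n s) → X)
          (fibY : X → Finset (PBond (F.P (K₀ + K + 1)) (K₀ + K + 1)))
          (Old : SeqOfRecord F θ.ν θ.τ9.M (histB₁₃ θ K₀ g₀ K) (K₀ + K + 1) (K₀ + K + 1) → Finset X)
          (slot : X → (Σ _ : ℕ, (Fin 4 → ℕ))) (G : X → Gen PEv),
          (∀ s', kr K (keyB₁₃ θ K₀ g₀ K s') ∈ badClassK₁₃ θ K₀ g₀ kr bd K 0 → chain s' 0 = s') ∧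
          (∀ s', kr K (keyB₁₃ θ K₀ g₀ K s') ∈ badClassK₁₃ θ K₀ g₀ kr bd K 0 → ∀ i : Fin (n s'), ∀ᵐ V ∂fieldMeasure (F.P (K₀ + K + 1)) (K₀ + K + 1) (SU N),
            fibreIntegral (fibY (comp s' i)) (fun V => chiSeqOfRecord F N θ.ν θ.τ9.M (histB₁₃ θ K₀ g₀ K) (K₀ + K + 1) (K₀ + K + 1) (chain s' i.castSucc) V *
                slotsOfRecord F N θ.ν θ.τ9 (EOfRecord₁₃ F N θ.toStage13Params) (wOfRecord₉ F N θ.toStage9Params) θ.ppSel (runB₁₃ F K₀ g₀ K) (histB₁₃ θ K₀ g₀ K) (K₀ + K + 1) (chain s' i.castSucc) V) V ≤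
              Real.exp (-2) * (Real.exp (-credits (T4PrintedShapeBanking.credit C₀ (fun j => histB₁₃ θ K₀ g₀ K (min j (K₀ + K + 1)))) (G (comp s' i))) *
              Real.exp (lifeCost (dictW (fun s => RkOfRecord F.L r (histB₁₃ θ K₀ g₀ K s)) C₀.n₁) (T4PrintedShapeBanking.cost C₀ (K₀ + K + 1) (fun s => RkOfRecord F.L r (histB₁₃ θ K₀ g₀ K s))) (G (comp s' i)))) *
              fibreIntegral (fibY (comp s' i)) (fun V => chiSeqOfRecord F N θ.ν θ.τ9.M (histB₁₃ θ K₀ g₀ K) (K₀ + K + 1) (K₀ + K + 1) (chain s' i.succ) V *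
                slotsOfRecord F N θ.ν θ.τ9 (EOfRecord₁₃ F N θ.toStage13Params) (wOfRecord₉ F N θ.toStage9Params) θ.ppSel (runB₁₃ F K₀ g₀ K) (histB₁₃ θ K₀ g₀ K) (K₀ + K + 1) (chain s' i.succ) V) V) ∧
          (∀ s', kr K (keyB₁₃ θ K₀ g₀ K s') ∈ badClassK₁₃ θ K₀ g₀ kr bd K 0 → kr K (keyB₁₃ θ K₀ g₀ K (chain s' (Fin.last (n s')))) ∉ badClassK₁₃ θ K₀ g₀ kr bd K 0) ∧
          (∀ σ s', kr K (keyB₁₃ θ K₀ g₀ K s') ∈ badClassK₁₃ θ K₀ g₀ kr bd K 0 → chain s' (Fin.last (n s')) = σ →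
            (∀ i, comp s' i ∈ Old σ) ∧ 0 < n s' ∧ Function.Injective (comp s')) ∧
          (∀ σ, Set.InjOn (fun s' => (Finset.univ : Finset (Fin (n s'))).image (comp s')) {s' | kr K (keyB₁₃ θ K₀ g₀ K s') ∈ badClassK₁₃ θ K₀ g₀ kr bd K 0 ∧ chain s' (Fin.last (n s')) = σ}) ∧
          (∀ σ, ∀ Y ∈ Old σ, (slot Y).1 < K₀ + jstar K + 1) ∧
          (∀ σ, ∀ Y ∈ Old σ, (slot Y).2 ∈ Fintype.piFinset fun _ : Fin 4 => Finset.range (2 * F.L ^ F.m * F.L ^ ((K₀ + K + 1) - (slot Y).1))) ∧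
          (∀ σ, ∀ Y ∈ Old σ, Consistent C₀ (K₀ + K + 1) (fun s => RkOfRecord F.L r (histB₁₃ θ K₀ g₀ K s)) (G Y)) ∧
          (∀ σ, ∀ Y ∈ Old σ, (G Y).WF (dictW (fun s => RkOfRecord F.L r (histB₁₃ θ K₀ g₀ K s)) C₀.n₁)) ∧
          (∀ σ, ∀ Y ∈ Old σ, K₀ + K + 1 < (G Y).reach (dictW (fun s => RkOfRecord F.L r (histB₁₃ θ K₀ g₀ K s)) C₀.n₁)) ∧ (∀ σ, ∀ Y ∈ Old σ, Chrono PEv.step (G Y)) ∧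
          (∀ σ, ∀ Y ∈ Old σ, ∀ e ∈ (G Y).events, e.kind = 0 → e.fat < Dcap (K₀ + K + 1)) ∧ (∀ σ, ∀ Y ∈ Old σ, fuel (G Y) ≤ Ncap (K₀ + K + 1)) ∧
          (∀ σ, ∀ Y ∈ Old σ, (G Y).rootStep = (slot Y).1) ∧
          (∀ σ, ∀ j < K₀ + jstar K + 1, ∀ zc ∈ (Fintype.piFinset fun _ : Fin 4 => Finset.range (2 * F.L ^ F.m * F.L ^ ((K₀ + K + 1) - j))),
            ∀ G₀ ∈ canonFam Dcap Ncap (K₀ + K + 1) j,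
            ((((Old σ).filter fun Y => slot Y = ⟨j, zc⟩ ∧ relabel shape (G Y) = G₀).card : ℕ) : ℝ) ≤ M ^ partnerAges PEv.step G₀)) →
      RelWeightBound 1 (classSetK₁₃ θ K₀ g₀ kr) (weightAK₁₃ θ hP K₀ g₀ os kr) (weightBK₁₃ θ hP K₀ g₀ os kr) (badClassK₁₃ θ K₀ g₀ kr bd)
        (fun K => 1 - Real.exp (-(birthMass C₀ * Real.exp (-κ₁) * (((2 * F.L ^ F.m : ℕ) : ℝ) ^ 4) *
          ((((F.L : ℝ) ^ 4) * Real.exp (ηplus - κ₁)) ^ (K - jstar K + 1) / (1 - ((F.L : ℝ) ^ 4) * Real.exp (ηplus - κ₁)))))) := by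
  obtain ⟨κ₁, E₀, γ₀, hκ, hE, hγ, hr, hx₀⟩ :=
    exists_margins_smallCoupling_relWeightBound_chronoGenealogies_ofRecord_undressedAE_of_liveSel (F := F) (X := X) C₀ hCv ha hA hμ₀ hβ hrq hM hη
  refine ⟨κ₁, E₀, hκ, hE, hr, ?_⟩
  intro N _ θ hP K₀ kr bd c hc jstar hjK hfrac β' hβ' hβL hsel hU hζsign Dcap Ncap
  -- the face's coupling ceiling `γ₀` IS the prefix's threshold; any `g₁` serves (the face does not read the renormalised coupling)
  refine ⟨γ₀, hγ, fun γ _ hγle => ⟨1, one_pos, fun g _ _ g₀ htuned h27 os hLA hLB => ?_⟩⟩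
  -- (F)'s interval row IS the tuning binder: the datum's run flow IS the history of record (`flow_g_datumOfRecord₁₃CoPH`, `rfl`), and `γ ≤ γ₀`
  have hI : ∀ K, Step.InInterval γ₀ (K₀ + K) (histA₁₃ θ K₀ g₀ K) := fun K k hk => by
    have h := (htuned (K₀ + K)).1 k hk
    exact ⟨h.1, h.2.trans hγle⟩
  exact hx₀ θ hP K₀ g₀ os kr bd c hc jstar hjK hfrac β' hβ' hβL hI h27 hsel hU hζsign Dcap Ncap hLA hLB

end Prefix

end YMDAG.UVSplit
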